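import Summits.CriticalPhenomena.PercolationContinuityZ3.Theorems.PercNearOneGluingNoHeavyLowerTailSwitchRelaxCheckN
import HarnessLib

/-!
# `NoHeavyLowerTail` (stmt-CriticalPhenomena-4575) — the FINITE RELAXATION of three-copy switching certificates, IIe:
# the VECTORISED pair check (one big-number addition per program instead of one table maximum per code pair)

Support file (prover prim-cert-2 gen 12; `--supports stmt-CriticalPhenomena-4575`).  No named facts, no sorries.

The pair condition `PairOK T0 TP LY LZ` (`λ₀ + Σ_p max λ_p ≤ 0` for all listed code pairs) costs, checked pair by pair,
`|LY|·|LZ|·(#programs)` kernel steps.  Here the inner loop over `LZ` is moved into GMP arithmetic: for a program table `T`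
and a `Y`-mask `u` the vector `j ↦ max λ_T(u, mask_j(b_j)) + K` over the `Z`-codes is packed into ONE natural number in
base `2^40` (`rowVec`, computed once per `(T, u)` thanks to `withVal`); for a `Y`-code `a` the packed vectors of its masks
are added (`rowSum`, `Svec`: `#programs + 1` big additions) and the base-`2^40` digits of the sum are compared with
`(#programs + 1)·K` (`digitsLE`).  Offsets `K = 2^20` make the summands nonnegative (`clampK`; clamping at `0` only
weakens the summands upwards, so it is sound without a lower bound on the potentials), and the kernel-checked bound
"all table entries `≤ K`" (`tablesLE`) keeps every digit below the base.  `pairOK_of_vecCheckN` is the soundness theorem.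
-/

namespace Summit.CriticalPhenomena.PercolationContinuityZ3.Theorems

namespace SwitchRelax

/-! ### Constants and packing -/

/-- The offset `K = 2^20`. [this work] -/
def KOFF : ℕ := 1048576
/-- The base `2^40` of the packed vectors. [this work] -/
def BASE : ℕ := 1099511627776
/-- Clamp-and-offset an integer entry to a natural number. [this work] -/
def clampK (v : ℤ) : ℕ := (v + KOFF).toNat
/-- Positional value (base `BASE`) of a digit list. [folklore] -/
def evalB : List ℕ → ℕ
  | [] => 0
  | d :: ds => d + BASE * evalB ds

/-- Packed vector, over the shifted `Z`-codes `LZs`, of the offset maxima of table `T` against `Y`-mask `ma`. [this work] -/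
def rowVec (T : List (List ℤ)) (ma : ℕ) : List ℕ → ℕ
  | [] => 0
  | cb :: LZs => withVal (cb % 32768) (fun mb => clampK (bestM T ma mb)) + BASE * rowVec T ma LZs
/-- Sum over the programs of the packed vectors selected by the `Y`-code's masks. [this work] -/
def rowSum : List (List (List ℤ)) → ℕ → List ℕ → ℕ
  | T :: Ts, ca, LZs => withVal (ca % 32768) (fun ma => rowVec T ma LZs) + rowSum Ts (ca / 32768) (LZs.map (· / 32768))
  | [], _, _ => 0
/-- Packed vector of the offset input potentials `λ₀(ta, ·)` over the unmixed `Z`-codes. [this work] -/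
def vec0 (T0 : List (List ℤ)) (ta : ℕ) : List ℕ → ℕ
  | [] => 0
  | zb :: LZu => withVal (zb % 16) (fun tb => clampK (get2 T0 ta tb)) + BASE * vec0 T0 ta LZu
/-- The packed vector of offset values of the unmixed `Y`-code `ya` against all unmixed `Z`-codes. [this work] -/
def Svec (T0 : List (List ℤ)) (TP : List (List (List ℤ))) (ya : ℕ) (LZu : List ℕ) : ℕ :=
  withVal (ya % 16) (fun ta => vec0 T0 ta LZu) + rowSum TP (ya / 16) (LZu.map (· / 16))
/-- All base-`BASE` digits (the first `m`) are `≤ KK`. [this work] -/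
def digitsLE (KK : ℕ) : ℕ → ℕ → Bool
  | _, 0 => true
  | n, m + 1 => Nat.ble (n % BASE) KK && digitsLE KK (n / BASE) m
/-- All entries of a table are `≤ KOFF`. [this work] -/
def tableLE (T : List (List ℤ)) : Bool := T.all fun row => row.all fun v => decide (v ≤ (KOFF : ℤ))
/-- **THE VECTORISED PAIR CHECK.** [this work] -/
def vecCheckN (T0 : List (List ℤ)) (TP : List (List (List ℤ))) (LY LZ : List ℕ) : Bool :=
  tableLE T0 && TP.all tableLE && Nat.blt ((TP.length + 1) * (2 * KOFF)) BASE &&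
    LY.all fun a => digitsLE ((TP.length + 1) * KOFF) (Svec T0 TP (unmix a) (LZ.map unmix)) LZ.length

/-! ### What the packed sums are -/

/-- Offset digit of a code pair, program part (aligned with `sumBestM`). [this work] -/
def dsumP : List (List (List ℤ)) → ℕ → ℕ → ℕ
  | T :: Ts, ca, cb => clampK (bestM T (ca % 32768) (cb % 32768)) + dsumP Ts (ca / 32768) (cb / 32768)
  | [], _, _ => 0
/-- Offset digit of an unmixed code pair. [this work] -/
def dsum (T0 : List (List ℤ)) (TP : List (List (List ℤ))) (ya zb : ℕ) : ℕ :=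
  clampK (get2 T0 (ya % 16) (zb % 16)) + dsumP TP (ya / 16) (zb / 16)

/-- Adding two packed vectors over the same index list. [folklore] -/
theorem evalB_map_add {α : Type} (f g : α → ℕ) : ∀ L : List α,
    evalB (L.map f) + evalB (L.map g) = evalB (L.map fun x => f x + g x)
  | [] => rfl
  | x :: L => by simp only [List.map_cons, evalB]; rw [← evalB_map_add f g L]; ring

/-- `rowVec` is a packed vector. [this work] -/
theorem rowVec_eq (T : List (List ℤ)) (ma : ℕ) : ∀ LZs : List ℕ,
    rowVec T ma LZs = evalB (LZs.map fun cb => clampK (bestM T ma (cb % 32768)))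
  | [] => rfl
  | cb :: LZs => by simp only [rowVec, withVal_eq, List.map_cons, evalB, rowVec_eq T ma LZs]

/-- `vec0` is a packed vector. [this work] -/
theorem vec0_eq (T0 : List (List ℤ)) (ta : ℕ) : ∀ LZu : List ℕ,
    vec0 T0 ta LZu = evalB (LZu.map fun zb => clampK (get2 T0 ta (zb % 16)))
  | [] => rfl
  | zb :: LZu => by simp only [vec0, withVal_eq, List.map_cons, evalB, vec0_eq T0 ta LZu]

/-- `rowSum` is the packed vector of the program parts of the offset digits. [this work] -/
theorem rowSum_eq : ∀ (TP : List (List (List ℤ))) (ca : ℕ) (LZs : List ℕ),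
    rowSum TP ca LZs = evalB (LZs.map fun cb => dsumP TP ca cb)
  | [], ca, LZs => by
    have h0 : ∀ L : List ℕ, evalB (L.map fun _ => (0 : ℕ)) = 0 := by
      intro L; induction L with
      | nil => rfl
      | cons x L ih => simp only [List.map_cons, evalB, ih, Nat.mul_zero]
    simp only [rowSum, dsumP, h0]
  | T :: Ts, ca, LZs => by
    rw [rowSum, withVal_eq, rowVec_eq, rowSum_eq Ts, List.map_map, evalB_map_add]
    rfl

/-- **`Svec` is the packed vector of the offset digits `dsum`.** [this work] -/
theorem Svec_eq (T0 : List (List ℤ)) (TP : List (List (List ℤ))) (ya : ℕ) (LZu : List ℕ) :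
    Svec T0 TP ya LZu = evalB (LZu.map fun zb => dsum T0 TP ya zb) := by
  rw [Svec, withVal_eq, vec0_eq, rowSum_eq, List.map_map, evalB_map_add]
  rfl

/-! ### Digits -/

/-- Reading the digits of a packed vector whose digits are below the base. [folklore] -/
theorem le_of_digitsLE {KK : ℕ} : ∀ (ds : List ℕ), (∀ d ∈ ds, d < BASE) →
    digitsLE KK (evalB ds) ds.length = true → ∀ d ∈ ds, d ≤ KK
  | [], _, _ => by simp
  | d :: ds, hB, h => by
    have hd : d < BASE := hB d List.mem_cons_self
    simp only [List.length_cons, digitsLE, evalB, Bool.and_eq_true, Nat.ble_eq] at h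
    rw [Nat.add_mul_mod_self_left, Nat.mod_eq_of_lt hd, Nat.add_mul_div_left _ _ (by decide), Nat.div_eq_of_lt hd,
      zero_add] at h
    intro x hx
    rcases List.mem_cons.1 hx with rfl | hx
    · exact h.1
    · exact le_of_digitsLE ds (fun y hy => hB y (List.mem_cons_of_mem _ hy)) h.2 x hx

/-! ### Bounds on table entries, maxima and digits -/

/-- An entry read with `getN` is the default or a member. [folklore] -/
theorem getN_mem_or {α : Type} : ∀ (l : List α) (n : ℕ) (d : α), getN l n d = d ∨ getN l n d ∈ l
  | [], _, _ => Or.inl rfl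
  | a :: l, 0, d => Or.inr (by simp [getN])
  | a :: l, n + 1, d => by
    rcases getN_mem_or l n d with h | h
    · exact Or.inl (by simpa [getN] using h)
    · exact Or.inr (by simp [getN, h])

/-- Entries of a bounded table are bounded. [this work] -/
theorem get2_le_of_tableLE {T : List (List ℤ)} (h : tableLE T = true) (s t : ℕ) : get2 T s t ≤ KOFF := by
  simp only [tableLE, List.all_eq_true, decide_eq_true_iff] at h
  rw [get2]
  rcases getN_mem_or (getN T s []) t 0 with h0 | hmem
  · rw [h0]; exact Int.natCast_nonneg _
  · rcases getN_mem_or T s [] with hrow | hrow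
    · rw [hrow] at hmem; simp at hmem
    · exact h _ hrow _ hmem

/-- Maxima over a bounded table are bounded (`bot` included). [this work] -/
theorem bestM_le_of_tableLE {T : List (List ℤ)} (h : tableLE T = true) (ma mb : ℕ) : bestM T ma mb ≤ KOFF := by
  rw [bestM]
  have key : ∀ (L : List ℤ), (∀ v ∈ L, v ≤ (KOFF : ℤ)) → L.foldr max bot ≤ KOFF := by
    intro L hL
    induction L with
    | nil => simp only [List.foldr_nil, bot, KOFF]; norm_num
    | cons v L ih =>
      rw [List.foldr_cons]
      exact max_le (hL v List.mem_cons_self) (ih fun w hw => hL w (List.mem_cons_of_mem _ hw))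
  refine key _ fun v hv => ?_
  simp only [List.mem_flatMap, List.mem_map] at hv
  obtain ⟨q, _, q', _, rfl⟩ := hv
  exact get2_le_of_tableLE h q q'

/-- The offset clamp of a bounded entry is at most `2 K`. [this work] -/
theorem clampK_le {v : ℤ} (h : v ≤ KOFF) : clampK v ≤ 2 * KOFF := by
  rw [clampK]
  have : v + KOFF ≤ ((2 * KOFF : ℕ) : ℤ) := by push_cast; linarith
  exact (Int.toNat_le_toNat this).trans (by simp)

/-- The offset clamp dominates the offset value. [this work] -/
theorem le_clampK (v : ℤ) : v + KOFF ≤ (clampK v : ℤ) := by rw [clampK]; exact Int.self_le_toNat _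

/-- The program part of an offset digit is bounded. [this work] -/
theorem dsumP_le : ∀ (TP : List (List (List ℤ))), (∀ T ∈ TP, tableLE T = true) → ∀ ca cb : ℕ,
    dsumP TP ca cb ≤ TP.length * (2 * KOFF)
  | [], _, _, _ => by simp [dsumP]
  | T :: Ts, h, ca, cb => by
    rw [dsumP, List.length_cons, Nat.succ_mul, add_comm (Ts.length * _)]
    exact Nat.add_le_add (clampK_le (bestM_le_of_tableLE (h T List.mem_cons_self) _ _))
      (dsumP_le Ts (fun T' hT' => h T' (List.mem_cons_of_mem _ hT')) _ _)

/-- The program part of an offset digit dominates the offset sum of maxima. [this work] -/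
theorem sumBestM_le_dsumP : ∀ (TP : List (List (List ℤ))) (ca cb : ℕ),
    sumBestM TP ca cb + TP.length * (KOFF : ℤ) ≤ dsumP TP ca cb
  | [], _, _ => by simp [sumBestM, dsumP]
  | T :: Ts, ca, cb => by
    simp only [sumBestM, withVal_eq, dsumP, List.length_cons, Nat.cast_add, Nat.cast_succ]
    have h1 := le_clampK (bestM T (ca % 32768) (cb % 32768))
    have h2 := sumBestM_le_dsumP Ts (ca / 32768) (cb / 32768)
    linarith

/-! ### Soundness of the vectorised check -/

/-- **The vectorised check establishes the pair condition.** [this work] -/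
theorem pairOK_of_vecCheckN {T0 : List (List ℤ)} {TP : List (List (List ℤ))} {LY LZ : List ℕ}
    (h : vecCheckN T0 TP LY LZ = true) : PairOK T0 TP LY LZ := by
  simp only [vecCheckN, Bool.and_eq_true, List.all_eq_true, Nat.blt_eq] at h
  obtain ⟨⟨⟨hT0, hTP⟩, hbase⟩, hall⟩ := h
  intro a ha b hb
  have hdig := hall a ha
  rw [Svec_eq] at hdig
  -- all digits are below the base
  have hlt : ∀ d ∈ (LZ.map unmix).map (fun zb => dsum T0 TP (unmix a) zb), d < BASE := by
    intro d hd
    simp only [List.map_map, List.mem_map, Function.comp] at hd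
    obtain ⟨b', _, rfl⟩ := hd
    refine lt_of_le_of_lt ?_ hbase
    rw [dsum, Nat.succ_mul, add_comm (TP.length * _)]
    exact Nat.add_le_add (clampK_le (get2_le_of_tableLE hT0 _ _)) (dsumP_le TP hTP _ _)
  have hlen : ((LZ.map unmix).map fun zb => dsum T0 TP (unmix a) zb).length = LZ.length := by simp
  rw [← hlen] at hdig
  have hle := le_of_digitsLE _ hlt hdig (dsum T0 TP (unmix a) (unmix b))
    (List.mem_map.2 ⟨unmix b, List.mem_map.2 ⟨b, hb, rfl⟩, rfl⟩)
  -- unpack the offsets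
  have h0 := le_clampK (get2 T0 (unmix a % 16) (unmix b % 16))
  have hP := sumBestM_le_dsumP TP (unmix a / 16) (unmix b / 16)
  have hle' : (dsum T0 TP (unmix a) (unmix b) : ℤ) ≤ ((TP.length + 1) * KOFF : ℕ) := by exact_mod_cast hle
  rw [dsum] at hle'
  push_cast at hle'
  rw [valM, valCore, withVal_eq, withVal_eq]
  linarith

end SwitchRelax

end Summit.CriticalPhenomena.PercolationContinuityZ3.Theorems
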